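import Mathlib
import HarnessLib
import Literature.Computability.Complexity.SymmetricCircuit
import Literature.Computability.Complexity.ConstantDepth
import Literature.ModelTheory.FiniteModelTheory.StructCkEquiv
import Summits.ValiantsHypothesis.ValiantsHypothesis.Theorems.SymmetryDialAffineOrbits
import Summits.ValiantsHypothesis.ValiantsHypothesis.Theorems.SymmetryDialAffinePebble

/-!
# SymmetryDial — the transfer statement `T` at budget `k = 0` (rung `T(0)`)

`AffineLogicTransfer` (`Theorems/SymmetryDialAffineCFISplit.lean`, rev 4) says: budget-`k` admissible
`AGL_d`-symmetric threshold circuits of ANY size cannot separate two `0/1`-matrices whose affine matrix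
structures are `C^{k′}`-equivalent.  This file proves its bottom rung **`k = 0` with `k′ = 2`**:

1. `transcript_getD_eq` / `eval_eq_of_counts`: if every gate of a threshold circuit `Ψ` on the
   positions `𝔽₂^d × 𝔽₂^d` is fixed by an automorphism over EVERY `σ ∈ AGL_d` (budget `0`: `U = ∅`,
   `W = ⊤`), then by induction along the program order every gate value — hence `Ψ.eval` — depends on
   the input matrix `A` only through `dg A` (diagonal ones) and `od A` (off-diagonal ones): the input
   wires of a fixed gate form an `AGL_d`-invariant multiset, and `AGL_d` has two orbits on positions
   (`SymmetryDialAffineOrbits`).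
2. `counts_of_pebbleEquiv_two`: two rounds of the bijective pebble game on `𝔄_d(A)`, `𝔄_d(B)` force
   `dg A = dg B` and `od A = od B`.
3. `affineLogicTransfer_zero`: the `k = 0` instance of `T` (hypotheses = `Admissible 0` unfolded).

All statements are over tree declarations; the by-name corollary for `AffineLogicTransfer` lands in the
split file.
-/

set_option linter.dupNamespace false

namespace Summit.ValiantsHypothesis.ValiantsHypothesis.Theorems.SymmetryDialAffineTransferZero

open Finset Literature.Computability.Complexity Literature.Computability.Complexity.Circuit
open SymmetryDialAffineOrbits (AGL diag dg od addRight_mem countP_inputs_eq)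
open SymmetryDialAffinePebble (AffinePebbleEquiv affStr RelHolds AffRel Laff)
open Literature.ModelTheory.FiniteModelTheory

/-- `𝔽₂^d`. -/
abbrev V (d : ℕ) : Type := Fin d → Fin 2

variable {d : ℕ}

/-! ### 1. Budget-`0` circuits compute functions of `(dg, od)` -/

/-- Input positions read off a list of wires. -/
theorem filterMap_getLeft_map_relabel {ι : Type} {n : ℕ} (π : ι → ι) (τ : Equiv.Perm (Fin n))
    (ws : List (ι ⊕ ℕ)) :
    (ws.map (relabelWire π τ)).filterMap Sum.getLeft? = (ws.filterMap Sum.getLeft?).map π := by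
  induction ws with
  | nil => rfl
  | cons w ws ih =>
    rw [List.map_cons]
    cases w with
    | inl i =>
      rw [relabelWire_inl,
        List.filterMap_cons_some (show Sum.getLeft? (Sum.inl (π i) : ι ⊕ ℕ) = some (π i) from rfl),
        List.filterMap_cons_some (show Sum.getLeft? (Sum.inl i : ι ⊕ ℕ) = some i from rfl),
        List.map_cons, ih]
    | inr m =>
      rw [relabelWire_inr, List.filterMap_cons_none (by rfl), List.filterMap_cons_none (by rfl), ih]

/-- A `countP` over wires splits into input wires and gate wires. -/
theorem countP_split {ι : Type} (ws : List (ι ⊕ ℕ)) (p : ι ⊕ ℕ → Bool) :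
    ws.countP p = (ws.filterMap Sum.getLeft?).countP (fun i => p (.inl i)) +
      (ws.filterMap Sum.getRight?).countP (fun m => p (.inr m)) := by
  induction ws with
  | nil => simp
  | cons w ws ih =>
    cases w with
    | inl i =>
      simp only [List.countP_cons, List.filterMap_cons, Sum.getLeft?_inl, Sum.getRight?_inl, ih]
      by_cases h : p (.inl i) = true
      · simp [h]; omega
      · simp [h]
    | inr m =>
      simp only [List.countP_cons, List.filterMap_cons, Sum.getLeft?_inr, Sum.getRight?_inr, ih]
      by_cases h : p (.inr m) = true
      · simp [h]; omega
      · simp [h]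

/-- **Budget `0` ⇒ counting.** If every gate of the threshold circuit `Ψ` is fixed by an automorphism
over every `σ ∈ AGL_d`, all gate values agree on two matrices with the same `(dg, od)`. -/
theorem transcript_getD_eq (Ψ : Circuit (V d × V d)) (hB : Ψ.IsOver tcBasis)
    (hfix : ∀ (j : Fin Ψ.gates.length) (σ : ↥(AGL d)),
      ∃ τ : Equiv.Perm (Fin Ψ.gates.length), Ψ.IsInducedAut (diag σ.1) τ ∧ τ j = j)
    (A B : V d × V d → Bool) (hdg : dg A = dg B) (hod : od A = od B) :
    ∀ (j : ℕ) (hj : j < Ψ.gates.length),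
      (transcript A [] Ψ.gates).getD j false = (transcript B [] Ψ.gates).getD j false := by
  intro j
  induction j using Nat.strong_induction_on with
  | _ j ih =>
    intro hj
    rw [getD_transcript_eq_gateValue Ψ A j hj, getD_transcript_eq_gateValue Ψ B j hj, gateValue,
      gateValue]
    have hsym : (Ψ.gates[j]).fn.IsSymmetric := isSymmetric_of_mem_tcBasis (hB _ (List.getElem_mem hj))
    refine Gate.op_eq_op_of_fn_eq rfl hsym ?_
    rw [numOnes_eq_countP_ofFn (wireVal A (transcript A [] Ψ.gates)) (Ψ.gates[j]).args,
      numOnes_eq_countP_ofFn (wireVal B (transcript B [] Ψ.gates)) (Ψ.gates[j]).args,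
      countP_split, countP_split]
    congr 1
    · -- input wires: an `AGL_d`-invariant multiset of positions
      refine countP_inputs_eq _ (fun σ hσ p => ?_) A B hdg hod
      obtain ⟨τ, hτ, hτj⟩ := hfix ⟨j, hj⟩ ⟨σ, hσ⟩
      have hperm := (hτ.2 ⟨j, hj⟩).2
      have hτj' : Ψ.gates[τ ⟨j, hj⟩] = Ψ.gates[(⟨j, hj⟩ : Fin Ψ.gates.length)] :=
        congrArg (fun i : Fin Ψ.gates.length => Ψ.gates[i]) hτj
      rw [hτj'] at hperm
      have hp2 := hperm.filterMap Sum.getLeft?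
      rw [filterMap_getLeft_map_relabel] at hp2
      have hc := hp2.count_eq (diag σ p)
      rw [List.count_map_of_injective _ _ (SymmetryDialAffineOrbits.diag_injective σ)] at hc
      simpa [Fin.getElem_fin] using hc
    · -- gate wires: earlier gates, equal by induction
      refine List.countP_congr fun m hm => ?_
      obtain ⟨w, hw, hwm⟩ := List.mem_filterMap.1 hm
      obtain ⟨a, ha⟩ := List.mem_ofFn.1 hw
      cases w with
      | inl i => simp at hwm
      | inr m' =>
        simp only [Sum.getRight?_inr, Option.some.injEq] at hwm
        subst hwm
        have hmj : m' < j := Ψ.wf j hj a m' ha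
        simp only [wireVal]
        rw [ih m' hmj (hmj.trans hj)]

/-- If the output wire is fixed by every `σ ∈ AGL_d` and is an input position, then `d = 0`-like
degeneracy: every vector equals its first coordinate. -/
theorem eq_of_input_output_fixed {i : V d × V d} (hfixi : ∀ σ ∈ AGL d, diag σ i = i) (x : V d) :
    x = i.1 := by
  have h := congrArg Prod.fst (hfixi (Equiv.addRight (i.1 + x)) (addRight_mem _))
  simp only [SymmetryDialAffineOrbits.diag, Equiv.coe_addRight] at h
  -- h : i.1 + (i.1 + x) = i.1
  rwa [← add_assoc, SymmetryDialAffineOrbits.add_self, zero_add] at h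

/-- **Budget `0` ⇒ counting, at the output.** -/
theorem eval_eq_of_counts (Ψ : Circuit (V d × V d)) (hB : Ψ.IsOver tcBasis)
    (hsymm : ∀ σ : ↥(AGL d), ∃ τ : Equiv.Perm (Fin Ψ.gates.length), Ψ.IsInducedAut (diag σ.1) τ)
    (hfix : ∀ (j : Fin Ψ.gates.length) (σ : ↥(AGL d)),
      ∃ τ : Equiv.Perm (Fin Ψ.gates.length), Ψ.IsInducedAut (diag σ.1) τ ∧ τ j = j)
    (A B : V d × V d → Bool) (hdg : dg A = dg B) (hod : od A = od B) : Ψ.eval A = Ψ.eval B := by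
  rw [eval_eq_wireVal, eval_eq_wireVal]
  cases hout : Ψ.output with
  | inr m =>
    simp only [wireVal]
    exact transcript_getD_eq Ψ hB hfix A B hdg hod m (Ψ.wf_output m hout)
  | inl i =>
    simp only [wireVal]
    have hfixi : ∀ σ ∈ AGL d, diag σ i = i := fun σ hσ => by
      obtain ⟨τ, hτ⟩ := hsymm ⟨σ, hσ⟩
      have h := hτ.1
      rw [hout, relabelWire_inl, Sum.inl.injEq] at h
      exact h
    have hsub : ∀ x : V d, x = i.1 := eq_of_input_output_fixed hfixi
    have hi : i = (i.1, i.1) := Prod.ext rfl (hsub i.2)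
    have huniv : (univ : Finset (V d)) = {i.1} :=
      eq_singleton_iff_unique_mem.2 ⟨mem_univ _, fun x _ => hsub x⟩
    have hcard : ∀ f : V d × V d → Bool, dg f = if f i = true then 1 else 0 := by
      intro f
      rw [dg, huniv, filter_singleton, ← hi]
      by_cases hf : f i = true
      · rw [if_pos hf, if_pos hf, card_singleton]
      · rw [if_neg hf, if_neg hf, card_empty]
    have h := hdg
    rw [hcard A, hcard B] at h
    by_cases hA : A i = true
    · by_cases hB' : B i = true
      · rw [hA, hB']
      · rw [if_pos hA, if_neg hB'] at h; exact absurd h one_ne_zero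
    · by_cases hB' : B i = true
      · rw [if_neg hA, if_pos hB'] at h; exact absurd h.symm one_ne_zero
      · rw [Bool.eq_false_iff.2 hA, Bool.eq_false_iff.2 hB']

/-! ### 2. Two pebble rounds force equal `(dg, od)` -/

/-- A sort-preserving consequence of a pebbled pair: points go to points. -/
theorem exists_inl_of_partialIso {A B : V d × V d → Bool}
    {p : PebblePosition 2 (V d ⊕ V d) (V d ⊕ V d)}
    (hp : @PebblePosition.IsPartialIso 2 (V d ⊕ V d) (V d ⊕ V d) Laff (affStr A) (affStr B) p)
    {x : V d} {b : V d ⊕ V d} (hpeb : p.Pebbled (.inl x) b) : ∃ x' : V d, b = .inl x' := by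
  have h := hp.2 AffRel.pt (fun _ => Sum.inl x) (fun _ => b) fun _ => hpeb
  have hl : @FirstOrder.Language.Structure.RelMap Laff (V d ⊕ V d) (affStr A) 1 AffRel.pt
      (fun _ => Sum.inl x) := ⟨x, rfl⟩
  obtain ⟨x', hx'⟩ := h.1 hl
  exact ⟨x', hx'⟩

/-- The matrix entry on a pair of pebbled points is preserved. -/
theorem mat_iff_of_partialIso {A B : V d × V d → Bool}
    {p : PebblePosition 2 (V d ⊕ V d) (V d ⊕ V d)}
    (hp : @PebblePosition.IsPartialIso 2 (V d ⊕ V d) (V d ⊕ V d) Laff (affStr A) (affStr B) p)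
    {x y x' y' : V d} (hx : p.Pebbled (.inl x) (.inl x')) (hy : p.Pebbled (.inl y) (.inl y')) :
    A (x, y) = true ↔ B (x', y') = true := by
  have h := hp.2 AffRel.mat ![Sum.inl x, Sum.inl y] ![Sum.inl x', Sum.inl y'] fun j => by
    fin_cases j
    · exact hx
    · exact hy
  have hl : @FirstOrder.Language.Structure.RelMap Laff (V d ⊕ V d) (affStr A) 2 AffRel.mat
      ![Sum.inl x, Sum.inl y] ↔ A (x, y) = true := by
    show (∃ a b : V d, _ ∧ _ ∧ _) ↔ _
    constructor
    · rintro ⟨a, b, ha, hb, hab⟩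
      simp only [Matrix.cons_val_zero, Matrix.cons_val_one, Sum.inl.injEq] at ha hb
      rw [ha, hb]; exact hab
    · intro hab; exact ⟨x, y, rfl, rfl, hab⟩
  have hr : @FirstOrder.Language.Structure.RelMap Laff (V d ⊕ V d) (affStr B) 2 AffRel.mat
      ![Sum.inl x', Sum.inl y'] ↔ B (x', y') = true := by
    show (∃ a b : V d, _ ∧ _ ∧ _) ↔ _
    constructor
    · rintro ⟨a, b, ha, hb, hab⟩
      simp only [Matrix.cons_val_zero, Matrix.cons_val_one, Sum.inl.injEq] at ha hb
      rw [ha, hb]; exact hab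
    · intro hab; exact ⟨x', y', rfl, rfl, hab⟩
  rw [← hl, ← hr]
  exact h

/-- **Two pebble rounds force equal counts.** -/
theorem counts_of_pebbleEquiv_two (A B : V d × V d → Bool) (h : AffinePebbleEquiv 2 d A B) :
    dg A = dg B ∧ od A = od B := by
  classical
  obtain ⟨S, hS⟩ := h
  -- round 1: pebble 0 on `(a, f₁ a)`
  obtain ⟨f₁, hf₁⟩ := S.move S.empty_mem 0
  set p₁ : (V d ⊕ V d) → PebblePosition 2 (V d ⊕ V d) (V d ⊕ V d) :=
    fun a => Function.update PebblePosition.empty 0 (some (a, f₁ a)) with hp₁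
  have hpeb₁ : ∀ a, (p₁ a).Pebbled a (f₁ a) := fun a => ⟨0, by simp [hp₁]⟩
  -- points go to points under f₁: g
  have hg : ∀ x : V d, ∃ x' : V d, f₁ (.inl x) = .inl x' := fun x =>
    exists_inl_of_partialIso (hS (hf₁ (.inl x))) (hpeb₁ (.inl x))
  choose g hg using hg
  have hg_inj : Function.Injective g := fun x y hxy =>
    Sum.inl_injective (f₁.injective (by rw [hg x, hg y, hxy]))
  have hg_surj : Function.Surjective g := Finite.surjective_of_injective hg_inj
  have hpebg : ∀ x : V d, (p₁ (.inl x)).Pebbled (.inl x) (.inl (g x)) := fun x => by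
    rw [← hg x]; exact hpeb₁ _
  have hdiag : ∀ x, A (x, x) = true ↔ B (g x, g x) = true := fun x =>
    mat_iff_of_partialIso (hS (hf₁ (.inl x))) (hpebg x) (hpebg x)
  refine ⟨?_, ?_⟩
  · -- dg
    exact card_bij (fun x _ => g x) (fun x hx => by simp [(hdiag x).1 (mem_filter.1 hx).2])
      (fun x _ y _ hxy => hg_inj hxy)
      (fun y hy => by
        obtain ⟨x, rfl⟩ := hg_surj y
        exact ⟨x, by simp [(hdiag x).2 (mem_filter.1 hy).2], rfl⟩)
  · -- od: row by row, round 2 with pebble 1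
    have hrow : ∀ x : V d, ((univ.erase x).filter fun y : V d => A (x, y) = true).card =
        ((univ.erase (g x)).filter fun y : V d => B (g x, y) = true).card := by
      intro x
      obtain ⟨f₂, hf₂⟩ := S.move (hf₁ (.inl x)) 1
      have hpos : ∀ b, Function.update (p₁ (.inl x)) 1 (some (b, f₂ b)) ∈ S.positions := hf₂
      have hpeb0 : ∀ b, PebblePosition.Pebbled (Function.update (p₁ (.inl x)) 1 (some (b, f₂ b)))
          (.inl x) (.inl (g x)) := fun b => by
        obtain ⟨i, hi⟩ := hpebg x
        have hi0 : i = 0 := by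
          fin_cases i
          · rfl
          · simp [hp₁, PebblePosition.empty] at hi
        subst hi0
        exact ⟨0, by rw [Function.update_of_ne (by decide)]; exact hi⟩
      have hpeb1 : ∀ b, PebblePosition.Pebbled (Function.update (p₁ (.inl x)) 1 (some (b, f₂ b)))
          b (f₂ b) :=
        fun b => ⟨1, by simp⟩
      have hg₂ : ∀ y : V d, ∃ y' : V d, f₂ (.inl y) = .inl y' := fun y =>
        exists_inl_of_partialIso (hS (hpos (.inl y))) (hpeb1 (.inl y))
      choose g₂ hg₂ using hg₂
      have hg₂_inj : Function.Injective g₂ := fun y z hyz =>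
        Sum.inl_injective (f₂.injective (by rw [hg₂ y, hg₂ z, hyz]))
      have hg₂_surj : Function.Surjective g₂ := Finite.surjective_of_injective hg₂_inj
      have hpeb1' : ∀ y : V d, PebblePosition.Pebbled
          (Function.update (p₁ (.inl x)) 1 (some ((.inl y : V d ⊕ V d), f₂ (.inl y))))
          (.inl y) (.inl (g₂ y)) := fun y => by
        rw [← hg₂ y]; exact hpeb1 _
      have hmat : ∀ y, A (x, y) = true ↔ B (g x, g₂ y) = true := fun y =>
        mat_iff_of_partialIso (hS (hpos (.inl y))) (hpeb0 _) (hpeb1' y)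
      have heq : ∀ y, x = y ↔ g x = g₂ y := fun y => by
        have := (hS (hpos (.inl y))).1 (hpeb0 (.inl y)) (hpeb1' y)
        simpa using this
      exact card_bij (fun y _ => g₂ y)
        (fun y hy => by
          obtain ⟨hy1, hy2⟩ := mem_filter.1 hy
          refine mem_filter.2 ⟨mem_erase.2 ⟨fun h => (ne_of_mem_erase hy1) ((heq y).2 h.symm).symm,
            mem_univ _⟩, (hmat y).1 hy2⟩)
        (fun y _ z _ hyz => hg₂_inj hyz)
        (fun y' hy' => by
          obtain ⟨y, rfl⟩ := hg₂_surj y'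
          obtain ⟨hy1, hy2⟩ := mem_filter.1 hy'
          refine ⟨y, mem_filter.2 ⟨mem_erase.2 ⟨fun h => (ne_of_mem_erase hy1) ((heq y).1 h.symm).symm,
            mem_univ _⟩, (hmat y).2 hy2⟩, rfl⟩)
    show (∑ x : V d, _) = ∑ x : V d, _
    rw [sum_congr rfl fun x _ => hrow x]
    exact sum_bij (fun x _ => g x) (fun _ _ => mem_univ _) (fun x _ y _ hxy => hg_inj hxy)
      (fun y _ => by obtain ⟨x, rfl⟩ := hg_surj y; exact ⟨x, mem_univ _, rfl⟩) (fun _ _ => rfl)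

/-! ### 3. The rung `T(0)` -/

/-- At budget `0` a flag-let support is no constraint: every `σ ∈ AGL_d` must fix the gate. -/
theorem fix_of_supported_zero (Ψ : Circuit (V d × V d)) (j : Fin Ψ.gates.length)
    (h : ∃ (U : Finset (V d)) (W : AddSubgroup (V d)), U.card ≤ 0 ∧ W.index ≤ 2 ^ 0 ∧
      ∀ σ : ↥(AGL d), (∀ u ∈ U, σ.1 u = u) → (∀ v : V d, σ.1 v + v ∈ W) →
        ∃ τ : Equiv.Perm (Fin Ψ.gates.length), Ψ.IsInducedAut (diag σ.1) τ ∧ τ j = j)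
    (σ : ↥(AGL d)) : ∃ τ : Equiv.Perm (Fin Ψ.gates.length), Ψ.IsInducedAut (diag σ.1) τ ∧ τ j = j := by
  obtain ⟨U, W, hU, hW, hfix⟩ := h
  have hU0 : U = ∅ := Finset.card_eq_zero.1 (Nat.le_zero.1 hU)
  have hW1 : W = ⊤ := by
    rw [← AddSubgroup.index_eq_one]
    have := AddSubgroup.index_ne_zero_of_finite (H := W)
    simp only [pow_zero] at hW
    omega
  exact hfix σ (by simp [hU0]) (by simp [hW1])

/-- **Rung `T(0)` of the transfer statement** (`AffineLogicTransfer` at `k = 0`, with `k′ = 2`):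
budget-`0` admissible circuits of any size do not separate `C²`-equivalent affine matrix structures.
Hypotheses are `Admissible 0 Ψ` of the split file, unfolded (simple wiring is not needed). -/
theorem affineLogicTransfer_zero :
    ∃ k' : ℕ, ∀ (d : ℕ) (A B : V d × V d → Bool), AffinePebbleEquiv k' d A B →
      ∀ Ψ : Circuit (V d × V d), Ψ.IsOver tcBasis →
        (∀ σ : ↥(AGL d), ∃ τ : Equiv.Perm (Fin Ψ.gates.length), Ψ.IsInducedAut (diag σ.1) τ) →
        (∀ j : Fin Ψ.gates.length, ∃ (U : Finset (V d)) (W : AddSubgroup (V d)),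
          U.card ≤ 0 ∧ W.index ≤ 2 ^ 0 ∧
            ∀ σ : ↥(AGL d), (∀ u ∈ U, σ.1 u = u) → (∀ v : V d, σ.1 v + v ∈ W) →
              ∃ τ : Equiv.Perm (Fin Ψ.gates.length), Ψ.IsInducedAut (diag σ.1) τ ∧ τ j = j) →
        Ψ.eval A = Ψ.eval B := by
  refine ⟨2, fun d A B hAB Ψ hB hsymm hsupp => ?_⟩
  obtain ⟨hdg, hod⟩ := counts_of_pebbleEquiv_two A B hAB
  exact eval_eq_of_counts Ψ hB hsymm (fun j σ => fix_of_supported_zero Ψ j (hsupp j) σ) A B hdg hod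

end Summit.ValiantsHypothesis.ValiantsHypothesis.Theorems.SymmetryDialAffineTransferZero
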